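import Summits.BirchSwinnertonDyer.BirchSwinnertonDyer.Theorems.SylvesterTwoHeegnerIndexLevelFixingEtaStar
import Summits.BirchSwinnertonDyer.BirchSwinnertonDyer.Theorems.SylvesterTwoHeegnerIndexLevelFixingOrbitFormTransform
import HarnessLib

/-!
# (W2-b) `stub_levelFixingSeven` — THE CLASS IDENTITY `[Q_n^{AW}] = [Q_n] · η*` ON THE `AW`-CLASSES
# `(p, n) ≡ (7, 2), (16, 1) (mod 27, 3)`, EVERY LEVEL (crux `UpperOffV0HSYPlus`, stmt-BirchSwinnertonDyer-19804)

Cell `bsd-cm`, seat `bsd-cm-k7t-w2b` g0.  Helper toward `stmt-BirchSwinnertonDyer-19804` (`--supports … --as helper`); sequel of this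
seat's `…LevelFixingOrbitFormTransform.lean` (p750768: the partner `Q_n^{AW} = (Q_n ∘ adj(AW))/243` is a level-`243` Heegner form),
`…LevelFixingEtaStar.lean` (p751406: `η* = [(243, 243m, 61m²)]`, `η*² = 1`, and the W-class identity `[fricke 243 Q_n] = [Q_n]·η*`).
THEOREMS ONLY (no definition, no named fact, no instance, no notation, no `sorry`).  Currency: `fIdeal Δ f = (a, ω − k_f) ⊆ O_D = QO Δ`,
`classOf'`, `ClassGroup.mk_eq_mk_of_coe_ideal` (as in `classOf'_rawCompose`).

CONTENT.  For the reflection `AW = (81 −28; 243 −81)` of `S₃ ≤ Aut X₀(3⁵)` and its classes — the ones on which the decomposition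
involution at `w = (√−3)` carries `x(τ_n)` to `Φ(AW)·x(τ_n)` (kernel certificate p748342 `levelCert_seven_two` / `levelCert_sixteen_one`)
— the EXACT ideal identity in `O_{−243p²n²}`

  `(a′) · 𝔞_{Q_n} · 𝔞_{η*} = (9n ξ) · 𝔞_{Q_n^{AW}}`,  `ξ = ((6nP₁ − P₂) − p√−3)/2`,  `a′ = 9n²P₁ − 3nP₂ + P₃`,  `9nξ = 27n²P₁ − θ`

(`θ = ω − k_{Q_n}`, `θ² = −81n²P₁P₃ + 9nP₂θ`; found by the seat's exact numerics `lambdacheck.py` and verified as polynomial identities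
in `(s, t)`, `p = 27s + r`, `n = 3t + e`, by `symb_ideal.py`), whence ★★ `classOf'_partnerAW_eq_mul_etaStar`:
**`[Q_n^{AW}] = [Q_n] · η*` in `Cl(−243p²n²)`**.  With `orbitForm_AW_sylvesterTower` (p751214: `Q_n^{AW}` has the residue of `Q_n` and
CM point `(A·w₂₄₃) • τ_n`) this is the complete `(class, residue, sheet)` datum of the (W2-b) partner on these classes: an automorphism
of `ℂ` fixing `K` that translates the classes of discriminant `−243p²n²` by `η*` carries `j(τ_n)` to `j((A·w₂₄₃) • τ_n)`.

* §0 (generic, any commutative ring) `span_singleton_mul_span_pair_mul_span_pair_eq` — `(x)·(a,b)(c,d) = (y)·(e,f)` from the four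
  coordinate identities `x·(gen) = uᵢ·ye + vᵢ·yf` and a Bezout relation `α(u₁v₃ − u₃v₁) + β(u₃v₄ − u₄v₃) = 1`; and
  `classOf'_mul_eq_of_span_mul_fIdeal` — `[f][g] = [h]` from `(x)𝔞_f𝔞_g = (y)𝔞_h`.
* §1 ★★ `classOf'_partnerAW_eq_mul_etaStar` (the two classes, case split `p = 27s + r`, `n = 3t + e`; coordinates
  `(u₁,v₁) = (−81, 243)`, `(u₃,v₃) = (−28, 81)`, `u₂ = 6n(p+2)(p+9) − 28n²(P₁/3)`, `v₂ = −18n(p+2)(p+9) + 27n²P₁`,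
  `u₄ = (9P₃ − 28n(2p²−5p+36))/27`, `v₄ = −P₃ + 3n(2p²−5p+36)`; `u₁v₃ − u₃v₁ = 243`, `u₃v₄ − u₄v₃ ≡ 1 (mod 3)`).

NOT HERE: the `A²W`-classes `(7,1), (16,2)` (sibling file); (G2)-consumers; any Galois statement.  HONEST LABEL: no stub closed; nothing
asserted on 19804; X12.CMAtTwo NOT proved; BSD is proved for no curve.

## References
* D. A. Cox, *Primes of the form x² + ny²*, 2nd ed. (2013), §7.A Prop. 7.4, §7.B Thm. 7.7 (ii) (`𝔞_f`, `C(O) ≅ C(D)`), §3.A. [Cox2013]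
* B. H. Gross, *Heegner points on `X₀(N)`* (1984), §I.1, §5. [Gross1984]
* Y. Hu, J. Shu, H. Yin, Trans. AMS 372 (2019) = arXiv:1708.05266, §2.1–2.2 (S₃ = ⟨W, A⟩, case split mod 27). [HuShuYin2019]
-/

set_option autoImplicit false
-- the Summit-side namespace `Summit.BirchSwinnertonDyer.BirchSwinnertonDyer.…` (summit = problem) is mandated by D-0017
set_option linter.dupNamespace false

noncomputable section

open scoped Classical nonZeroDivisors QuadraticAlgebra

namespace Summit.BirchSwinnertonDyer.BirchSwinnertonDyer.Theorems.SylvesterTwoLevelFixingClassA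

open Literature.Computability.Cryptography.Hallgren2005
open Literature.Computability.Cryptography.Hallgren2005.OrderCl
open Literature.Computability.Cryptography.Hallgren2005.FormComposition (kOf mOf two_mul_kOf)
open Literature.NumberTheory.QuadraticFields.Quadratic
open Literature.NumberTheory.EllipticCurves Literature.NumberTheory.EllipticCurves.HeegnerForm
  Literature.NumberTheory.EllipticCurves.HuShuYin2019
  Summit.BirchSwinnertonDyer.BirchSwinnertonDyer.Theorems.SylvesterTwoLevelFixingOrbitA

/-! ## §0 From four coordinate identities to an ideal identity, and from an ideal identity to a class identity -/

/-- **`(x)·(a, b)(c, d) = (y)·(e, f)` in a commutative ring** from the coordinates of the four products `x·ac, x·ad, x·bc, x·bd` on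
`(ye, yf)` and a Bezout relation between the two minors `u₁v₃ − u₃v₁`, `u₃v₄ − u₄v₃` (which gives `ye, yf` back as combinations of
the four products). [cite: Cox2013, §7.A (ideals of an order as ℤ-lattices)] -/
theorem span_singleton_mul_span_pair_mul_span_pair_eq {R : Type*} [CommRing R]
    {x a b c d y e f u₁ v₁ u₂ v₂ u₃ v₃ u₄ v₄ α β : R}
    (h₁ : x * (a * c) = u₁ * (y * e) + v₁ * (y * f)) (h₂ : x * (a * d) = u₂ * (y * e) + v₂ * (y * f))
    (h₃ : x * (b * c) = u₃ * (y * e) + v₃ * (y * f)) (h₄ : x * (b * d) = u₄ * (y * e) + v₄ * (y * f))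
    (hαβ : α * (u₁ * v₃ - u₃ * v₁) + β * (u₃ * v₄ - u₄ * v₃) = 1) :
    Ideal.span {x} * (Ideal.span {a, b} * Ideal.span {c, d}) = Ideal.span {y} * Ideal.span {e, f} := by
  rw [Ideal.span_pair_mul_span_pair, OrderCl.span_singleton_mul_span_pair, Ideal.span_mul_span, Set.singleton_mul,
    Set.image_insert_eq, Set.image_insert_eq, Set.image_insert_eq, Set.image_singleton]
  apply le_antisymm
  · rw [Ideal.span_le]
    rintro z hz
    simp only [Set.mem_insert_iff, Set.mem_singleton_iff] at hz
    rcases hz with rfl | rfl | rfl | rfl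
    · exact Ideal.mem_span_pair.mpr ⟨u₁, v₁, h₁.symm⟩
    · exact Ideal.mem_span_pair.mpr ⟨u₂, v₂, h₂.symm⟩
    · exact Ideal.mem_span_pair.mpr ⟨u₃, v₃, h₃.symm⟩
    · exact Ideal.mem_span_pair.mpr ⟨u₄, v₄, h₄.symm⟩
  · rw [Ideal.span_le]
    rintro z hz
    simp only [Set.mem_insert_iff, Set.mem_singleton_iff] at hz
    set I : Ideal R := Ideal.span {x * (a * c), x * (a * d), x * (b * c), x * (b * d)} with hI
    have m₁ : x * (a * c) ∈ I := Ideal.subset_span (by simp)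
    have m₃ : x * (b * c) ∈ I := Ideal.subset_span (by simp)
    have m₄ : x * (b * d) ∈ I := Ideal.subset_span (by simp)
    rcases hz with rfl | rfl
    · have key : y * e = α * (v₃ * (x * (a * c)) - v₁ * (x * (b * c))) + β * (v₄ * (x * (b * c)) - v₃ * (x * (b * d))) := by
        linear_combination (-(α * v₃)) * h₁ + (α * v₁ - β * v₄) * h₃ + (β * v₃) * h₄ - (y * e) * hαβ
      rw [key]
      exact I.add_mem (I.mul_mem_left _ (I.sub_mem (I.mul_mem_left _ m₁) (I.mul_mem_left _ m₃)))
        (I.mul_mem_left _ (I.sub_mem (I.mul_mem_left _ m₃) (I.mul_mem_left _ m₄)))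
    · have key : y * f = α * (-(u₃ * (x * (a * c))) + u₁ * (x * (b * c))) + β * (-(u₄ * (x * (b * c))) + u₃ * (x * (b * d))) := by
        linear_combination (α * u₃) * h₁ + (-(α * u₁) + β * u₄) * h₃ + (-(β * u₃)) * h₄ - (y * f) * hαβ
      rw [key]
      exact I.add_mem (I.mul_mem_left _ (I.add_mem (I.neg_mem (I.mul_mem_left _ m₁)) (I.mul_mem_left _ m₃)))
        (I.mul_mem_left _ (I.add_mem (I.neg_mem (I.mul_mem_left _ m₃)) (I.mul_mem_left _ m₄)))

variable (Δ : NegDiscr)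

/-- **`[𝔞_f]·[𝔞_g] = [𝔞_h]` in `Cl(O_D)` from an ideal identity `(x)·𝔞_f𝔞_g = (y)·𝔞_h`**, `x, y ≠ 0` (the dictionary `C(D) ≅ C(O_D)`, Cox
Thm. 7.7, exactly as in the tree's `classOf'_rawCompose`). [cite: Cox2013, §7.B Thm. 7.7 (ii)] -/
theorem classOf'_mul_eq_of_span_mul_fIdeal {f g h : BinQF} (hf : f.IsPosPrim Δ.D) (hg : g.IsPosPrim Δ.D) (hh : h.IsPosPrim Δ.D)
    {x y : QO Δ} (hx : x ≠ 0) (hy : y ≠ 0)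
    (hI : Ideal.span {x} * (fIdeal Δ f * fIdeal Δ g) = Ideal.span {y} * fIdeal Δ h) :
    classOf' Δ f * classOf' Δ g = classOf' Δ h := by
  rw [classOf'_eq Δ hf, classOf'_eq Δ hg, classOf'_eq Δ hh, ← map_mul]
  refine (ClassGroup.mk_eq_mk_of_coe_ideal (I' := fIdeal Δ f * fIdeal Δ g) (J' := fIdeal Δ h) ?_ (val_fUnit Δ hh)).2
    ⟨x, y, hx, hy, hI⟩
  rw [Units.val_mul, val_fUnit, val_fUnit, FractionalIdeal.coeIdeal_mul]

/-- `z + w·(ω − k) ≠ 0` in `O_D` for integers `z, w, k` with `w ≠ 0` (its `ω`-coordinate is `w`). [folklore] -/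
theorem intCast_add_intCast_mul_omega_sub_ne_zero (z w : ℤ) {k : ℤ} (hw : w ≠ 0) :
    (z : QO Δ) + (w : QO Δ) * ((ω : QO Δ) - (k : QO Δ)) ≠ 0 := by
  intro h
  have him := congrArg QuadraticAlgebra.im h
  simp [QuadraticAlgebra.im_intCast, QuadraticAlgebra.re_intCast] at him
  exact hw him

/-! ## §1 The `AW`-classes: `[Q_n^{AW}] = [Q_n] · η*` -/

set_option maxHeartbeats 1600000 in
/-- ★★ **`[Q_n^{AW}] = [Q_n] · η*` in `Cl(−243p²n²)` on the classes `(p, n) ≡ (7, 2), (16, 1) (mod 27, 3)`** — the class identity of the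
(W2-b) partner on the `AW`-sheet (HSY §2.2; the seat's numerics §3): for `n ≥ 1`, `3 ∤ n`, `gcd(n, C) = 1`, `Δ.D = (9pn)²·(−3)`.  Proof: the
exact ideal identity `(a′)𝔞_{Q_n}𝔞_{η*} = (27n²P₁ − θ)𝔞_{Q_n^{AW}}` (module docstring) through §0.
[cite: Cox2013, §7.B Thm. 7.7, §3.A] [cite: Gross1984, §I.1] [cite: HuShuYin2019, §2.2] -/
theorem classOf'_partnerAW_eq_mul_etaStar {p n : ℕ} (hcls : p % 27 = 7 ∧ n % 3 = 2 ∨ p % 27 = 16 ∧ n % 3 = 1) (hn : n ≠ 0)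
    (hnC : IsCoprime (n : ℤ) (4 * (p : ℤ) ^ 2 + 18 * p + 81)) (hΔ : Δ.D = ((9 * p * n : ℕ) : ℤ) ^ 2 * (-3)) :
    classOf' Δ ⟨243 * (9 * (n : ℤ) ^ 2 * ((p : ℤ) ^ 2 + 4 * p + 16) - 3 * n * (4 * (p : ℤ) ^ 2 + 17 * p + 72) +
        (4 * (p : ℤ) ^ 2 + 18 * p + 81)),
      -(9 * (168 * (n : ℤ) ^ 2 * ((p : ℤ) ^ 2 + 4 * p + 16) - 55 * n * (4 * (p : ℤ) ^ 2 + 17 * p + 72) +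
        18 * (4 * (p : ℤ) ^ 2 + 18 * p + 81))),
      784 * (n : ℤ) ^ 2 * (((p : ℤ) ^ 2 + 4 * p + 16) / 3) - 84 * n * (4 * (p : ℤ) ^ 2 + 17 * p + 72) +
        27 * (4 * (p : ℤ) ^ 2 + 18 * p + 81)⟩ =
      classOf' Δ ⟨(n : ℤ) ^ 2 * (81 * ((p : ℤ) ^ 2 + 4 * p + 16)),
        (n : ℤ) * (-(9 * (4 * (p : ℤ) ^ 2 + 17 * p + 72))), 4 * (p : ℤ) ^ 2 + 18 * p + 81⟩ *
      classOf' Δ ⟨243, 243 * ((p * n : ℕ) : ℤ), 61 * ((p * n : ℕ) : ℤ) ^ 2⟩ := by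
  have hp3 : p % 3 = 1 := by omega
  have hn3 : ¬ 3 ∣ n := by omega
  have hm3 : ¬ 3 ∣ p * n := by
    intro h
    rcases (Nat.Prime.dvd_mul Nat.prime_three).mp h with h' | h'
    · omega
    · exact hn3 h'
  have hΔ' : Δ.D = ((9 * (p * n) : ℕ) : ℤ) ^ 2 * (-3) := by rw [hΔ, Nat.mul_assoc]
  -- the three forms
  set fQ : BinQF := ⟨(n : ℤ) ^ 2 * (81 * ((p : ℤ) ^ 2 + 4 * p + 16)),
    (n : ℤ) * (-(9 * (4 * (p : ℤ) ^ 2 + 17 * p + 72))), 4 * (p : ℤ) ^ 2 + 18 * p + 81⟩ with hfQ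
  set fη : BinQF := ⟨243, 243 * ((p * n : ℕ) : ℤ), 61 * ((p * n : ℕ) : ℤ) ^ 2⟩ with hfη
  set fT : BinQF := ⟨243 * (9 * (n : ℤ) ^ 2 * ((p : ℤ) ^ 2 + 4 * p + 16) - 3 * n * (4 * (p : ℤ) ^ 2 + 17 * p + 72) +
        (4 * (p : ℤ) ^ 2 + 18 * p + 81)),
      -(9 * (168 * (n : ℤ) ^ 2 * ((p : ℤ) ^ 2 + 4 * p + 16) - 55 * n * (4 * (p : ℤ) ^ 2 + 17 * p + 72) +
        18 * (4 * (p : ℤ) ^ 2 + 18 * p + 81))),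
      784 * (n : ℤ) ^ 2 * (((p : ℤ) ^ 2 + 4 * p + 16) / 3) - 84 * n * (4 * (p : ℤ) ^ 2 + 17 * p + 72) +
        27 * (4 * (p : ℤ) ^ 2 + 18 * p + 81)⟩ with hfT
  have hQ : fQ.IsPosPrim Δ.D := by
    have h := sylvesterForm_mem_heegnerForms hp3 hn hnC
    rw [← hΔ] at h
    exact ⟨h.1, h.2.1, (BinQF.isPrimitive_iff _).mpr h.2.2.2⟩
  have hη : fη.IsPosPrim Δ.D := isPosPrim_etaStar Δ hm3 hΔ'
  have hT : fT.IsPosPrim Δ.D := by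
    have h := partnerAW_mem_heegnerForms hp3 hn hn3 hnC
    rw [← hΔ] at h
    exact ⟨h.1, h.2.1, (BinQF.isPrimitive_iff _).mpr h.2.2.2⟩
  rw [eq_comm]
  -- `θ = ω − k(Q_n)` and `θ² = −ac − bθ`
  set θ : QO Δ := (ω : QO Δ) - (kOf Δ.D fQ : QO Δ) with hθ
  have hθθ : θ * θ = -((fQ.a : QO Δ) * (fQ.c : QO Δ)) - (fQ.b : QO Δ) * θ := by
    have h1 := omega_sub_mul_omega_sub (Δ := Δ) hQ
    have h2 := omega_sub_neg_eq (Δ := Δ) hQ.disc_eq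
    rw [h2] at h1
    rw [hθ]
    push_cast at h1
    linear_combination h1
  simp only [hfQ] at hθθ
  rcases hcls with ⟨hp27, hn'⟩ | ⟨hp27, hn'⟩

  · -- class (p, n) ≡ (7, 2) (mod 27, 3): `p = 27s + 7`, `n = 3t + 2`
    obtain ⟨s, rfl⟩ : ∃ s : ℕ, p = 27 * s + 7 := ⟨p / 27, by omega⟩
    obtain ⟨t, rfl⟩ : ∃ t : ℕ, n = 3 * t + 2 := ⟨n / 3, by omega⟩
    push_cast at hθθ
    -- the shifts `ω − k(η*) = θ + δ_η`, `ω − k(Q′) = θ + δ′` (`2k = b + D`)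
    have h2Q := two_mul_kOf (D := Δ.D) (f := fQ) hQ.disc_eq
    have hbQ : fQ.b = ((3 * t + 2 : ℕ) : ℤ) * (-(9 * (4 * ((27 * s + 7 : ℕ) : ℤ) ^ 2 + 17 * ((27 * s + 7 : ℕ) : ℤ) + 72))) := by
      rw [hfQ]
    have hkη : (ω : QO Δ) - (kOf Δ.D fη : QO Δ) = θ + (((-39366 * (s : ℤ) ^ 2 * (t : ℤ) - 26244 * (s : ℤ) ^ 2 - 36450 * (s : ℤ) * (t : ℤ) - 24300 * (s : ℤ) - 7776 * (t : ℤ) - 5184) : ℤ) : QO Δ) := by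
      have h2 := two_mul_kOf (D := Δ.D) (f := fη) hη.disc_eq
      have hb : fη.b = 243 * (((27 * s + 7) * (3 * t + 2) : ℕ) : ℤ) := by rw [hfη]
      have hδ : kOf Δ.D fη = kOf Δ.D fQ - (-39366 * (s : ℤ) ^ 2 * (t : ℤ) - 26244 * (s : ℤ) ^ 2 - 36450 * (s : ℤ) * (t : ℤ) - 24300 * (s : ℤ) - 7776 * (t : ℤ) - 5184) := by
        have h : 2 * kOf Δ.D fη = 2 * (kOf Δ.D fQ - (-39366 * (s : ℤ) ^ 2 * (t : ℤ) - 26244 * (s : ℤ) ^ 2 - 36450 * (s : ℤ) * (t : ℤ) - 24300 * (s : ℤ) - 7776 * (t : ℤ) - 5184)) := by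
          rw [h2, mul_sub, h2Q, hb, hbQ]; push_cast; ring
        exact mul_left_cancel₀ two_ne_zero h
      rw [hθ, hδ]; push_cast; ring
    have hkT : (ω : QO Δ) - (kOf Δ.D fT : QO Δ) = θ + (((4960116 * (s : ℤ) ^ 2 * (t : ℤ) ^ 2 + 4408992 * (s : ℤ) ^ 2 * (t : ℤ) + 3306744 * (s : ℤ) * (t : ℤ) ^ 2 + 971028 * (s : ℤ) ^ 2 + 2918916 * (s : ℤ) * (t : ℤ) + 632772 * (t : ℤ) ^ 2 + 638118 * (s : ℤ) + 551124 * (t : ℤ) + 118827) : ℤ) : QO Δ) := by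
      have h2 := two_mul_kOf (D := Δ.D) (f := fT) hT.disc_eq
      have hb : fT.b = -(9 * (168 * ((3 * t + 2 : ℕ) : ℤ) ^ 2 * (((27 * s + 7 : ℕ) : ℤ) ^ 2 + 4 * ((27 * s + 7 : ℕ) : ℤ) + 16) - 55 * ((3 * t + 2 : ℕ) : ℤ) * (4 * ((27 * s + 7 : ℕ) : ℤ) ^ 2 + 17 * ((27 * s + 7 : ℕ) : ℤ) + 72) + 18 * (4 * ((27 * s + 7 : ℕ) : ℤ) ^ 2 + 18 * ((27 * s + 7 : ℕ) : ℤ) + 81))) := by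
        rw [hfT]
      have hδ : kOf Δ.D fT = kOf Δ.D fQ - (4960116 * (s : ℤ) ^ 2 * (t : ℤ) ^ 2 + 4408992 * (s : ℤ) ^ 2 * (t : ℤ) + 3306744 * (s : ℤ) * (t : ℤ) ^ 2 + 971028 * (s : ℤ) ^ 2 + 2918916 * (s : ℤ) * (t : ℤ) + 632772 * (t : ℤ) ^ 2 + 638118 * (s : ℤ) + 551124 * (t : ℤ) + 118827) := by
        have h : 2 * kOf Δ.D fT = 2 * (kOf Δ.D fQ - (4960116 * (s : ℤ) ^ 2 * (t : ℤ) ^ 2 + 4408992 * (s : ℤ) ^ 2 * (t : ℤ) + 3306744 * (s : ℤ) * (t : ℤ) ^ 2 + 971028 * (s : ℤ) ^ 2 + 2918916 * (s : ℤ) * (t : ℤ) + 632772 * (t : ℤ) ^ 2 + 638118 * (s : ℤ) + 551124 * (t : ℤ) + 118827)) := by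
          rw [h2, mul_sub, h2Q, hb, hbQ]; push_cast; ring
        exact mul_left_cancel₀ two_ne_zero h
      rw [hθ, hδ]; push_cast; ring
    -- non-vanishing of the two scalars
    have hx : (((59049 * (s : ℤ) ^ 2 * (t : ℤ) ^ 2 + 52488 * (s : ℤ) ^ 2 * (t : ℤ) + 39366 * (s : ℤ) * (t : ℤ) ^ 2 + 11664 * (s : ℤ) ^ 2 + 34749 * (s : ℤ) * (t : ℤ) + 7533 * (t : ℤ) ^ 2 + 7668 * (s : ℤ) + 6561 * (t : ℤ) + 1429) : ℤ) : QO Δ) ≠ 0 := intCast_ne_zero Δ (by positivity)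
    have hy : (((177147 * (s : ℤ) ^ 2 * (t : ℤ) ^ 2 + 236196 * (s : ℤ) ^ 2 * (t : ℤ) + 118098 * (s : ℤ) * (t : ℤ) ^ 2 + 78732 * (s : ℤ) ^ 2 + 157464 * (s : ℤ) * (t : ℤ) + 22599 * (t : ℤ) ^ 2 + 52488 * (s : ℤ) + 30132 * (t : ℤ) + 10044) : ℤ) : QO Δ) + (((-1) : ℤ) : QO Δ) * θ ≠ 0 := by
      rw [hθ]; exact intCast_add_intCast_mul_omega_sub_ne_zero Δ _ _ (by norm_num)
    -- Bezout for the backward inclusion: `gcd(243, d) = 1`, `d = u₃v₄ − u₄v₃ ≡ 1 (mod 3)`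
    obtain ⟨α, β, hαβ⟩ : IsCoprime (243 : ℤ) (2916 * (s : ℤ) ^ 2 + 1998 * (s : ℤ) + 403) := by
      have hc3 : IsCoprime (3 : ℤ) (2916 * (s : ℤ) ^ 2 + 1998 * (s : ℤ) + 403) := ⟨-(972 * (s : ℤ) ^ 2 + 666 * (s : ℤ) + 134), 1, by ring⟩
      simpa using hc3.pow_left (m := 5)
    have hαβ' : (α : QO Δ) * ((((-81) : ℤ) : QO Δ) * (((81) : ℤ) : QO Δ) - (((-28) : ℤ) : QO Δ) * (((243) : ℤ) : QO Δ)) +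
        (β : QO Δ) * ((((-28) : ℤ) : QO Δ) * (((13122 * (s : ℤ) ^ 2 * (t : ℤ) + 5832 * (s : ℤ) ^ 2 + 5589 * (s : ℤ) * (t : ℤ) + 1728 * (s : ℤ) + 891 * (t : ℤ) + 191) : ℤ) : QO Δ) - (((-4536 * (s : ℤ) ^ 2 * (t : ℤ) - 2052 * (s : ℤ) ^ 2 - 1932 * (s : ℤ) * (t : ℤ) - 622 * (s : ℤ) - 308 * (t : ℤ) - 71) : ℤ) : QO Δ) * (((81) : ℤ) : QO Δ)) = 1 := by
      have h := congrArg (fun z : ℤ ↦ (z : QO Δ)) hαβ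
      push_cast at h ⊢
      linear_combination h
    refine classOf'_mul_eq_of_span_mul_fIdeal Δ hQ hη hT hx hy ?_
    simp only [fIdeal]
    rw [hkη, hkT, ← hθ]
    have haQ : (fQ.a : QO Δ) = ((((3 * t + 2 : ℕ) : ℤ) ^ 2 * (81 * (((27 * s + 7 : ℕ) : ℤ) ^ 2 + 4 * ((27 * s + 7 : ℕ) : ℤ) + 16)) : ℤ) : QO Δ) := by
      rw [hfQ]
    have haη : (fη.a : QO Δ) = ((243 : ℤ) : QO Δ) := by rw [hfη]
    rw [haQ, haη, hfT]
    push_cast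
    refine span_singleton_mul_span_pair_mul_span_pair_eq (u₁ := (((-81) : ℤ) : QO Δ)) (v₁ := (((243) : ℤ) : QO Δ))
      (u₂ := (((-61236 * (s : ℤ) ^ 2 * (t : ℤ) ^ 2 - 68526 * (s : ℤ) ^ 2 * (t : ℤ) - 40824 * (s : ℤ) * (t : ℤ) ^ 2 - 18468 * (s : ℤ) ^ 2 - 42282 * (s : ℤ) * (t : ℤ) - 7812 * (t : ℤ) ^ 2 - 10044 * (s : ℤ) - 7824 * (t : ℤ) - 1744) : ℤ) : QO Δ))
      (v₂ := (((177147 * (s : ℤ) ^ 2 * (t : ℤ) ^ 2 + 196830 * (s : ℤ) ^ 2 * (t : ℤ) + 118098 * (s : ℤ) * (t : ℤ) ^ 2 + 52488 * (s : ℤ) ^ 2 + 121014 * (s : ℤ) * (t : ℤ) + 22599 * (t : ℤ) ^ 2 + 28188 * (s : ℤ) + 22356 * (t : ℤ) + 4860) : ℤ) : QO Δ))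
      (u₃ := (((-28) : ℤ) : QO Δ)) (v₃ := (((81) : ℤ) : QO Δ))
      (u₄ := (((-4536 * (s : ℤ) ^ 2 * (t : ℤ) - 2052 * (s : ℤ) ^ 2 - 1932 * (s : ℤ) * (t : ℤ) - 622 * (s : ℤ) - 308 * (t : ℤ) - 71) : ℤ) : QO Δ))
      (v₄ := (((13122 * (s : ℤ) ^ 2 * (t : ℤ) + 5832 * (s : ℤ) ^ 2 + 5589 * (s : ℤ) * (t : ℤ) + 1728 * (s : ℤ) + 891 * (t : ℤ) + 191) : ℤ) : QO Δ))
      (α := (α : QO Δ)) (β := (β : QO Δ))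
      (by push_cast; linear_combination (((243) : QO Δ)) * hθθ)
      (by push_cast; linear_combination (((177147 * (s : QO Δ) ^ 2 * (t : QO Δ) ^ 2 + 196830 * (s : QO Δ) ^ 2 * (t : QO Δ) + 118098 * (s : QO Δ) * (t : QO Δ) ^ 2 + 52488 * (s : QO Δ) ^ 2 + 121014 * (s : QO Δ) * (t : QO Δ) + 22599 * (t : QO Δ) ^ 2 + 28188 * (s : QO Δ) + 22356 * (t : QO Δ) + 4860) : QO Δ)) * hθθ)
      (by push_cast; linear_combination (((81) : QO Δ)) * hθθ)
      (by push_cast; linear_combination (((59049 * (s : QO Δ) ^ 2 * (t : QO Δ) ^ 2 + 65610 * (s : QO Δ) ^ 2 * (t : QO Δ) + 39366 * (s : QO Δ) * (t : QO Δ) ^ 2 + 17496 * (s : QO Δ) ^ 2 + 40338 * (s : QO Δ) * (t : QO Δ) + 7533 * (t : QO Δ) ^ 2 + 9396 * (s : QO Δ) + 7452 * (t : QO Δ) + 1620) : QO Δ)) * hθθ)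
      (by push_cast at hαβ' ⊢; linear_combination hαβ')

  · -- class (p, n) ≡ (16, 1) (mod 27, 3): `p = 27s + 16`, `n = 3t + 1`
    obtain ⟨s, rfl⟩ : ∃ s : ℕ, p = 27 * s + 16 := ⟨p / 27, by omega⟩
    obtain ⟨t, rfl⟩ : ∃ t : ℕ, n = 3 * t + 1 := ⟨n / 3, by omega⟩
    push_cast at hθθ
    -- the shifts `ω − k(η*) = θ + δ_η`, `ω − k(Q′) = θ + δ′` (`2k = b + D`)
    have h2Q := two_mul_kOf (D := Δ.D) (f := fQ) hQ.disc_eq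
    have hbQ : fQ.b = ((3 * t + 1 : ℕ) : ℤ) * (-(9 * (4 * ((27 * s + 16 : ℕ) : ℤ) ^ 2 + 17 * ((27 * s + 16 : ℕ) : ℤ) + 72))) := by
      rw [hfQ]
    have hkη : (ω : QO Δ) - (kOf Δ.D fη : QO Δ) = θ + (((-39366 * (s : ℤ) ^ 2 * (t : ℤ) - 13122 * (s : ℤ) ^ 2 - 62694 * (s : ℤ) * (t : ℤ) - 20898 * (s : ℤ) - 24300 * (t : ℤ) - 8100) : ℤ) : QO Δ) := by
      have h2 := two_mul_kOf (D := Δ.D) (f := fη) hη.disc_eq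
      have hb : fη.b = 243 * (((27 * s + 16) * (3 * t + 1) : ℕ) : ℤ) := by rw [hfη]
      have hδ : kOf Δ.D fη = kOf Δ.D fQ - (-39366 * (s : ℤ) ^ 2 * (t : ℤ) - 13122 * (s : ℤ) ^ 2 - 62694 * (s : ℤ) * (t : ℤ) - 20898 * (s : ℤ) - 24300 * (t : ℤ) - 8100) := by
        have h : 2 * kOf Δ.D fη = 2 * (kOf Δ.D fQ - (-39366 * (s : ℤ) ^ 2 * (t : ℤ) - 13122 * (s : ℤ) ^ 2 - 62694 * (s : ℤ) * (t : ℤ) - 20898 * (s : ℤ) - 24300 * (t : ℤ) - 8100)) := by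
          rw [h2, mul_sub, h2Q, hb, hbQ]; push_cast; ring
        exact mul_left_cancel₀ two_ne_zero h
      rw [hθ, hδ]; push_cast; ring
    have hkT : (ω : QO Δ) - (kOf Δ.D fT : QO Δ) = θ + (((4960116 * (s : ℤ) ^ 2 * (t : ℤ) ^ 2 + 1102248 * (s : ℤ) ^ 2 * (t : ℤ) + 6613488 * (s : ℤ) * (t : ℤ) ^ 2 + 52488 * (s : ℤ) ^ 2 + 1449252 * (s : ℤ) * (t : ℤ) + 2286144 * (t : ℤ) ^ 2 + 67554 * (s : ℤ) + 489888 * (t : ℤ) + 22113) : ℤ) : QO Δ) := by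
      have h2 := two_mul_kOf (D := Δ.D) (f := fT) hT.disc_eq
      have hb : fT.b = -(9 * (168 * ((3 * t + 1 : ℕ) : ℤ) ^ 2 * (((27 * s + 16 : ℕ) : ℤ) ^ 2 + 4 * ((27 * s + 16 : ℕ) : ℤ) + 16) - 55 * ((3 * t + 1 : ℕ) : ℤ) * (4 * ((27 * s + 16 : ℕ) : ℤ) ^ 2 + 17 * ((27 * s + 16 : ℕ) : ℤ) + 72) + 18 * (4 * ((27 * s + 16 : ℕ) : ℤ) ^ 2 + 18 * ((27 * s + 16 : ℕ) : ℤ) + 81))) := by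
        rw [hfT]
      have hδ : kOf Δ.D fT = kOf Δ.D fQ - (4960116 * (s : ℤ) ^ 2 * (t : ℤ) ^ 2 + 1102248 * (s : ℤ) ^ 2 * (t : ℤ) + 6613488 * (s : ℤ) * (t : ℤ) ^ 2 + 52488 * (s : ℤ) ^ 2 + 1449252 * (s : ℤ) * (t : ℤ) + 2286144 * (t : ℤ) ^ 2 + 67554 * (s : ℤ) + 489888 * (t : ℤ) + 22113) := by
        have h : 2 * kOf Δ.D fT = 2 * (kOf Δ.D fQ - (4960116 * (s : ℤ) ^ 2 * (t : ℤ) ^ 2 + 1102248 * (s : ℤ) ^ 2 * (t : ℤ) + 6613488 * (s : ℤ) * (t : ℤ) ^ 2 + 52488 * (s : ℤ) ^ 2 + 1449252 * (s : ℤ) * (t : ℤ) + 2286144 * (t : ℤ) ^ 2 + 67554 * (s : ℤ) + 489888 * (t : ℤ) + 22113)) := by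
          rw [h2, mul_sub, h2Q, hb, hbQ]; push_cast; ring
        exact mul_left_cancel₀ two_ne_zero h
      rw [hθ, hδ]; push_cast; ring
    -- non-vanishing of the two scalars
    have hx : (((59049 * (s : ℤ) ^ 2 * (t : ℤ) ^ 2 + 13122 * (s : ℤ) ^ 2 * (t : ℤ) + 78732 * (s : ℤ) * (t : ℤ) ^ 2 + 729 * (s : ℤ) ^ 2 + 17253 * (s : ℤ) * (t : ℤ) + 27216 * (t : ℤ) ^ 2 + 945 * (s : ℤ) + 5832 * (t : ℤ) + 313) : ℤ) : QO Δ) ≠ 0 := intCast_ne_zero Δ (by positivity)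
    have hy : (((177147 * (s : ℤ) ^ 2 * (t : ℤ) ^ 2 + 118098 * (s : ℤ) ^ 2 * (t : ℤ) + 236196 * (s : ℤ) * (t : ℤ) ^ 2 + 19683 * (s : ℤ) ^ 2 + 157464 * (s : ℤ) * (t : ℤ) + 81648 * (t : ℤ) ^ 2 + 26244 * (s : ℤ) + 54432 * (t : ℤ) + 9072) : ℤ) : QO Δ) + (((-1) : ℤ) : QO Δ) * θ ≠ 0 := by
      rw [hθ]; exact intCast_add_intCast_mul_omega_sub_ne_zero Δ _ _ (by norm_num)
    -- Bezout for the backward inclusion: `gcd(243, d) = 1`, `d = u₃v₄ − u₄v₃ ≡ 1 (mod 3)`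
    obtain ⟨α, β, hαβ⟩ : IsCoprime (243 : ℤ) (2916 * (s : ℤ) ^ 2 + 3942 * (s : ℤ) + 1393) := by
      have hc3 : IsCoprime (3 : ℤ) (2916 * (s : ℤ) ^ 2 + 3942 * (s : ℤ) + 1393) := ⟨-(972 * (s : ℤ) ^ 2 + 1314 * (s : ℤ) + 464), 1, by ring⟩
      simpa using hc3.pow_left (m := 5)
    have hαβ' : (α : QO Δ) * ((((-81) : ℤ) : QO Δ) * (((81) : ℤ) : QO Δ) - (((-28) : ℤ) : QO Δ) * (((243) : ℤ) : QO Δ)) +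
        (β : QO Δ) * ((((-28) : ℤ) : QO Δ) * (((13122 * (s : ℤ) ^ 2 * (t : ℤ) + 1458 * (s : ℤ) ^ 2 + 14337 * (s : ℤ) * (t : ℤ) + 837 * (s : ℤ) + 4212 * (t : ℤ) + 11) : ℤ) : QO Δ) - (((-4536 * (s : ℤ) ^ 2 * (t : ℤ) - 540 * (s : ℤ) ^ 2 - 4956 * (s : ℤ) * (t : ℤ) - 338 * (s : ℤ) - 1456 * (t : ℤ) - 21) : ℤ) : QO Δ) * (((81) : ℤ) : QO Δ)) = 1 := by
      have h := congrArg (fun z : ℤ ↦ (z : QO Δ)) hαβ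
      push_cast at h ⊢
      linear_combination h
    refine classOf'_mul_eq_of_span_mul_fIdeal Δ hQ hη hT hx hy ?_
    simp only [fIdeal]
    rw [hkη, hkT, ← hθ]
    have haQ : (fQ.a : QO Δ) = ((((3 * t + 1 : ℕ) : ℤ) ^ 2 * (81 * (((27 * s + 16 : ℕ) : ℤ) ^ 2 + 4 * ((27 * s + 16 : ℕ) : ℤ) + 16)) : ℤ) : QO Δ) := by
      rw [hfQ]
    have haη : (fη.a : QO Δ) = ((243 : ℤ) : QO Δ) := by rw [hfη]
    rw [haQ, haη, hfT]
    push_cast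
    refine span_singleton_mul_span_pair_mul_span_pair_eq (u₁ := (((-81) : ℤ) : QO Δ)) (v₁ := (((243) : ℤ) : QO Δ))
      (u₂ := (((-61236 * (s : ℤ) ^ 2 * (t : ℤ) ^ 2 - 27702 * (s : ℤ) ^ 2 * (t : ℤ) - 81648 * (s : ℤ) * (t : ℤ) ^ 2 - 2430 * (s : ℤ) ^ 2 - 33534 * (s : ℤ) * (t : ℤ) - 28224 * (t : ℤ) ^ 2 - 2106 * (s : ℤ) - 10716 * (t : ℤ) - 436) : ℤ) : QO Δ))
      (v₂ := (((177147 * (s : ℤ) ^ 2 * (t : ℤ) ^ 2 + 78732 * (s : ℤ) ^ 2 * (t : ℤ) + 236196 * (s : ℤ) * (t : ℤ) ^ 2 + 6561 * (s : ℤ) ^ 2 + 94770 * (s : ℤ) * (t : ℤ) + 81648 * (t : ℤ) ^ 2 + 5346 * (s : ℤ) + 30132 * (t : ℤ) + 972) : ℤ) : QO Δ))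
      (u₃ := (((-28) : ℤ) : QO Δ)) (v₃ := (((81) : ℤ) : QO Δ))
      (u₄ := (((-4536 * (s : ℤ) ^ 2 * (t : ℤ) - 540 * (s : ℤ) ^ 2 - 4956 * (s : ℤ) * (t : ℤ) - 338 * (s : ℤ) - 1456 * (t : ℤ) - 21) : ℤ) : QO Δ))
      (v₄ := (((13122 * (s : ℤ) ^ 2 * (t : ℤ) + 1458 * (s : ℤ) ^ 2 + 14337 * (s : ℤ) * (t : ℤ) + 837 * (s : ℤ) + 4212 * (t : ℤ) + 11) : ℤ) : QO Δ))
      (α := (α : QO Δ)) (β := (β : QO Δ))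
      (by push_cast; linear_combination (((243) : QO Δ)) * hθθ)
      (by push_cast; linear_combination (((177147 * (s : QO Δ) ^ 2 * (t : QO Δ) ^ 2 + 78732 * (s : QO Δ) ^ 2 * (t : QO Δ) + 236196 * (s : QO Δ) * (t : QO Δ) ^ 2 + 6561 * (s : QO Δ) ^ 2 + 94770 * (s : QO Δ) * (t : QO Δ) + 81648 * (t : QO Δ) ^ 2 + 5346 * (s : QO Δ) + 30132 * (t : QO Δ) + 972) : QO Δ)) * hθθ)
      (by push_cast; linear_combination (((81) : QO Δ)) * hθθ)
      (by push_cast; linear_combination (((59049 * (s : QO Δ) ^ 2 * (t : QO Δ) ^ 2 + 26244 * (s : QO Δ) ^ 2 * (t : QO Δ) + 78732 * (s : QO Δ) * (t : QO Δ) ^ 2 + 2187 * (s : QO Δ) ^ 2 + 31590 * (s : QO Δ) * (t : QO Δ) + 27216 * (t : QO Δ) ^ 2 + 1782 * (s : QO Δ) + 10044 * (t : QO Δ) + 324) : QO Δ)) * hθθ)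
      (by push_cast at hαβ' ⊢; linear_combination hαβ')

end Summit.BirchSwinnertonDyer.BirchSwinnertonDyer.Theorems.SylvesterTwoLevelFixingClassA

end
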